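import Summits.ABC.IUTFork.LDHEstimateAssembly
import Literature.IUT.LogVolume.Theorem110Assembly
import HarnessLib

/-!
# The fork at [IUTchIII] Corollary 3.12, L-DH level: the LOCAL PROOF DATA of [IUTchIV] Theorem 1.10 from
# Dupuy–Hilado data and per-prime weighted-average bounds

Record-only file (D-0012) of the abc-iut cell (campaign-S seat abc-iut-S2; `plan/LDH-SPEC.md` D9′); TAKES NO
SIDE. abc-iut-S3's `Literature.IUT.LogVolume.Thm110Numerics.LocalProofDataAvg` (`Theorem110Assembly.lean`) is
the per-`v_ℚ` input of Theorem 1.10's arithmetic: local data `D_{v_ℚ}` (Prop. 1.7 weights, `log(𝔡^K_v)`,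
`log(q_v)`, `log(p_{v_ℚ})`, `ι_{v_ℚ}`), component volumes `vol(v_ℚ, j, e⃗)` with the PRINTED weighted-average bound
of Step (v) (p. 28, final display), the Step (vi) remainder `Z ≤ 0`, the bound `−|log(Θ)| ≤ Σ procAvg wavg vol
+ Z + procAvg (j+1)·log(π)` (Steps (iv), (vii)), and the Step (ii)/(iii)/Def. 1.9 bookkeeping; from it
`LocalProofDataAvg.toProofData` and `theorem110_of_localAvg` give Thm. 1.10's displays (given `Cor312`).

THIS FILE builds that structure FROM A DUPUY–HILADO MODEL (`Summit.ABC.IUTFork.DHData`, abc-iut-c312-3) —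
`LocalProofDataAvg.ofDH` — taking as inputs exactly:
* the distinguished primes `dst ⊆ T` and local data `D_p` on `E_p := V(F)_p` (`placesOver F p`) with the
  weights `λ_v = [F_v:ℚ_p]` (so that `wavg` IS Dupuy–Hilado's expectation, `HullVolumeAssembly`);
* `vol(p, j, e⃗) := log μ̄_{e⃗}(hull(U_Θ)_{p,j,e⃗})`, the components of the hull region of the model (NOT a free
  input);
* the Step (v) printed weighted-average bounds at `p ∈ dst` and the Step (vi) vanishing `log μ̄ ≤ 0` of the
  hull components off `dst` — the per-summand VOLUME INPUTS (campaign files of S7/S8/c312-d1 discharge them at the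
  real tensor-packet instance; here hypotheses);
* the NORMALISATION DICTIONARY as two hypotheses: `l` of the numerics `=` `l` of the pilot data, and
  `−|log(Θ)| = ln ν̄_𝕃(hull(U_Θ)) + arch` with `arch ≤ procAvg_j (j+1)·log(π)` (Step (vii): the archimedean
  component, which `𝕃` does not carry, bounded as printed) — the identification of [IUTchIII] Cor. 3.12's
  procession-normalised mono-analytic log-volume with Dupuy–Hilado's `ln ν̄_𝕃` is NOT proved here (it is the
  c312 crew's `VerbatimDHAgreement` / `Cor312StatementBridge` business) but NAMED;
* S3's Step (ii)/(iii)/Def. 1.9 fields verbatim (sums over `dst`).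
Then `Z := Σ_{p ∈ T∖dst} ln ν̄_{𝕃_p}(hull(U_Θ)) ≤ 0` and `negLogTheta_le` are THEOREMS
(`LDHEstimateAssembly` / `HullVolumeAssembly`), and `theorem110_of_DH` is Thm. 1.10's conclusion for the model
from these inputs, `IsEtaPrm η_prm`, `l ≠ 5` and the hypothesis `Cor312`.

Sources: Mochizuki, *IUT IV* (RIMS ms Apr. 2020), proof of Thm. 1.10 pp. 23–31; Dupuy–Hilado
arXiv:2004.13228 §1, Def. 3.6.3, §4.10–4.12. [claim: Mochizuki2012, status: disputed]
Deliberately NOT here: the per-summand bounds; the dictionary proofs; any judgement on [IUTchIII] Cor. 3.12.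
-/

noncomputable section

namespace Summit.ABC.IUTFork

namespace DHData

open Finset Literature.IUT.LogVolume Literature.IUT.LogVolume.Thm110Local
  Literature.IUT.LogVolume.Thm110Numerics NumberField IsDedekindDomain

variable {F : Type} [Field F] [NumberField F] (D : DHData F)

/-- The distinguished primes as a finset of the TYPE of primes (the index type `ι` of S3's local proof data
must make every `E_ι = V(F)_p` nonempty, which holds for primes). [folklore] -/
def primesOf (dst : Finset ℕ) (hprime : ∀ p ∈ dst, p.Prime) : Finset {p : ℕ // p.Prime} :=
  dst.attach.map ⟨fun q => ⟨q.1, hprime q.1 q.2⟩, fun a b h => Subtype.ext (by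
    have := congrArg Subtype.val h; exact this)⟩

/-- Membership in `primesOf`. [folklore] -/
theorem mem_primesOf {dst : Finset ℕ} {hprime : ∀ p ∈ dst, p.Prime} {q : {p : ℕ // p.Prime}} :
    q ∈ primesOf dst hprime ↔ q.1 ∈ dst := by
  unfold primesOf
  simp only [Finset.mem_map, Finset.mem_attach, Function.Embedding.coeFn_mk, true_and, Subtype.exists]
  constructor
  · rintro ⟨a, ha, rfl⟩; exact ha
  · intro h; exact ⟨q.1, h, Subtype.ext rfl⟩

/-- Sums over `primesOf dst` are sums over `dst`. [folklore] -/
theorem sum_primesOf {dst : Finset ℕ} {hprime : ∀ p ∈ dst, p.Prime} (f : ℕ → ℝ) :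
    ∑ q ∈ primesOf dst hprime, f q.1 = ∑ p ∈ dst, f p := by
  unfold primesOf
  rw [Finset.sum_map]
  exact Finset.sum_attach dst f

/-- **The local proof data of [IUTchIV] Thm. 1.10 from a Dupuy–Hilado model.** See the module docstring for
the list of inputs; the volume fields `vol`, `Z`, `hZ`, `negLogTheta_le` are COMPUTED from the model
(`vol :=` the hull components, `Z :=` the off-`dst` part of `ln ν̄_𝕃(hull(U_Θ))`, `≤ 0` by the Step (vi)
hypothesis, `negLogTheta_le` by `HullVolumeAssembly`). [claim: Mochizuki2012, status: disputed] -/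
def localProofDataAvgOfDH (X : Thm110Numerics) (hl : X.l = D.X.l)
    {dst : Finset ℕ} (hdst : dst ⊆ D.T)
    (Dloc : (p : ℕ) → DstLocal (placesOver F p))
    (hlam : ∀ p ∈ dst, ∀ v, (Dloc p).lam v = localDegree F v.1)
    (hwavg : ∀ p ∈ dst, ∀ j, 1 ≤ j → j ≤ X.lhalf →
      @DstLocal.wavg _ _ (Dloc p) (j + 1) (fun e => D.M.logμ (D.M.hullUTheta D.ind3 p j e)) ≤
        ((j : ℝ) + 1) * (Dloc p).avg (Dloc p).logDK
          - (j : ℝ) ^ 2 / (2 * (2 * (X.lhalf : ℝ) + 1)) * (Dloc p).avg (Dloc p).logQ + (Dloc p).logp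
          + 4 * ((j : ℝ) + 1) * ((Dloc p).iota * X.lstar))
    (hoff : ∀ p ∈ D.T, p ∉ dst → ∀ j, 1 ≤ j → j ≤ D.X.lstar → ∀ e,
      D.M.logμ (D.M.hullUTheta D.ind3 p j e) ≤ 0)
    (arch : ℝ) (hnegLogTheta : X.negLogTheta = D.negLogThetaDH + arch)
    (harch : arch ≤ procAvg X.lhalf (fun j => ((j : ℝ) + 1) * Real.log Real.pi))
    (logDiffK logCondK : ℝ) (logCondK_nonneg : 0 ≤ logCondK)
    (sum_logDK : ∑ p ∈ dst, (Dloc p).avg (Dloc p).logDK = logDiffK)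
    (sum_logQ : ∑ p ∈ dst, (Dloc p).avg (Dloc p).logQ = X.logq)
    (tpd_le_F : X.logDiffTpd + X.logCondTpd ≤ X.logDiffF + X.logCondF)
    (F_le : X.logDiffF + X.logCondF ≤ X.logDiffTpd + X.logCondTpd + Real.log (2 ^ 11 * 3 ^ 3 * 5 ^ 2))
    (K_le : logDiffK + logCondK ≤ X.logDiffF + X.logCondF + 2 * Real.log X.l)
    (sQ_le : ∑ p ∈ dst, (Dloc p).logp ≤
      2 * (X.dmod : ℝ) * (X.logDiffTpd + X.logCondTpd) + Real.log (2 * 3 * 5 * (X.l : ℝ)))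
    (sLe_le : ∑ p ∈ dst, (Dloc p).iota ≤ (Nat.primeCounting (X.estar * X.l) : ℝ)) :
    X.LocalProofDataAvg :=
  haveI hprime : ∀ p ∈ dst, p.Prime := fun p hp => D.T_prime p (hdst hp)
  haveI hlh : X.lhalf = D.X.lstar := by
    have h1 := X.l_eq_two_mul_lhalf_add_one
    have h2 := D.X.l_eq
    omega
  { ι := {p : ℕ // p.Prime}
    dst := primesOf dst hprime
    E := fun q => placesOver F q.1
    instFintype := fun _ => inferInstance
    instNonempty := fun q => @nonempty_placesOver F _ _ q.1 ⟨q.2⟩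
    D := fun q => Dloc q.1
    vol := fun q j e => D.M.logμ (D.M.hullUTheta D.ind3 q.1 j e)
    hwavg := fun q hq j hj1 hj2 => hwavg q.1 (mem_primesOf.mp hq) j hj1 hj2
    Z := ∑ p ∈ D.T \ dst, D.M.lnνLp D.X.lstar p (D.M.hullUTheta D.ind3)
    hZ := D.M.sum_sdiff_lnνLp_nonpos D.X.lstar hoff
    negLogTheta_le := by
      have hEq : D.negLogThetaDH =
          (∑ p ∈ dst, procAvg D.X.lstar (fun j =>
            @DstLocal.wavg _ _ (Dloc p) (j + 1) (fun e => D.M.logμ (D.M.hullUTheta D.ind3 p j e))))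
            + ∑ p ∈ D.T \ dst, D.M.lnνLp D.X.lstar p (D.M.hullUTheta D.ind3) := by
        unfold negLogThetaDH
        rw [D.M.lnνL_eq_sum_dst_add D.X.lstar hdst]
        congr 1
        rw [← D.M.lnνL_eq_sum_procAvg_wavg D.X.lstar dst hprime Dloc hlam _]
        rfl
      rw [sum_primesOf (fun p => procAvg X.lhalf (fun j =>
            @DstLocal.wavg _ _ (Dloc p) (j + 1) (fun e => D.M.logμ (D.M.hullUTheta D.ind3 p j e)))),
        hnegLogTheta, hEq, hlh]
      rw [hlh] at harch
      linarith
    logDiffK := logDiffK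
    logCondK := logCondK
    logCondK_nonneg := logCondK_nonneg
    sum_logDK := by rw [sum_primesOf (fun p => (Dloc p).avg (Dloc p).logDK)]; exact sum_logDK
    sum_logQ := by rw [sum_primesOf (fun p => (Dloc p).avg (Dloc p).logQ)]; exact sum_logQ
    tpd_le_F := tpd_le_F
    F_le := F_le
    K_le := K_le
    sQ_le := by rw [sum_primesOf (fun p => (Dloc p).logp)]; exact sQ_le
    sLe_le := by rw [sum_primesOf (fun p => (Dloc p).iota)]; exact sLe_le }

/-- **[IUTchIV] Theorem 1.10 for a Dupuy–Hilado model**, from the per-prime weighted-average (Step (v)) and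
vanishing (Step (vi)) bounds on the components of `hull(U_Θ)`, the normalisation dictionary, the Step
(ii)/(iii)/Def. 1.9 bookkeeping, the prime number theorem input `IsEtaPrm η_prm` (PROVED in the tree:
`exists_isEtaPrm`), `l ≠ 5`, and the HYPOTHESIS `Cor312` ([IUTchIII] Cor. 3.12, disputed):
`C_Θ`-admissibility, `C_Θ ≥ −1` and both displayed inequalities. [claim: Mochizuki2012, status: disputed] -/
theorem theorem110_of_DH (X : Thm110Numerics) (hl : X.l = D.X.l)
    {dst : Finset ℕ} (hdst : dst ⊆ D.T)
    (Dloc : (p : ℕ) → DstLocal (placesOver F p))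
    (hlam : ∀ p ∈ dst, ∀ v, (Dloc p).lam v = localDegree F v.1)
    (hwavg : ∀ p ∈ dst, ∀ j, 1 ≤ j → j ≤ X.lhalf →
      @DstLocal.wavg _ _ (Dloc p) (j + 1) (fun e => D.M.logμ (D.M.hullUTheta D.ind3 p j e)) ≤
        ((j : ℝ) + 1) * (Dloc p).avg (Dloc p).logDK
          - (j : ℝ) ^ 2 / (2 * (2 * (X.lhalf : ℝ) + 1)) * (Dloc p).avg (Dloc p).logQ + (Dloc p).logp
          + 4 * ((j : ℝ) + 1) * ((Dloc p).iota * X.lstar))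
    (hoff : ∀ p ∈ D.T, p ∉ dst → ∀ j, 1 ≤ j → j ≤ D.X.lstar → ∀ e,
      D.M.logμ (D.M.hullUTheta D.ind3 p j e) ≤ 0)
    (arch : ℝ) (hnegLogTheta : X.negLogTheta = D.negLogThetaDH + arch)
    (harch : arch ≤ procAvg X.lhalf (fun j => ((j : ℝ) + 1) * Real.log Real.pi))
    (logDiffK logCondK : ℝ) (logCondK_nonneg : 0 ≤ logCondK)
    (sum_logDK : ∑ p ∈ dst, (Dloc p).avg (Dloc p).logDK = logDiffK)
    (sum_logQ : ∑ p ∈ dst, (Dloc p).avg (Dloc p).logQ = X.logq)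
    (tpd_le_F : X.logDiffTpd + X.logCondTpd ≤ X.logDiffF + X.logCondF)
    (F_le : X.logDiffF + X.logCondF ≤ X.logDiffTpd + X.logCondTpd + Real.log (2 ^ 11 * 3 ^ 3 * 5 ^ 2))
    (K_le : logDiffK + logCondK ≤ X.logDiffF + X.logCondF + 2 * Real.log X.l)
    (sQ_le : ∑ p ∈ dst, (Dloc p).logp ≤
      2 * (X.dmod : ℝ) * (X.logDiffTpd + X.logCondTpd) + Real.log (2 * 3 * 5 * (X.l : ℝ)))
    (sLe_le : ∑ p ∈ dst, (Dloc p).iota ≤ (Nat.primeCounting (X.estar * X.l) : ℝ))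
    (hη : IsEtaPrm X.etaPrm) (hne : X.l ≠ 5) (hcor : X.Cor312) :
    X.CThetaAdmissible ∧ -1 ≤ X.CTheta ∧ X.Display ∧ X.DisplayF :=
  (D.localProofDataAvgOfDH X hl hdst Dloc hlam hwavg hoff arch hnegLogTheta harch logDiffK logCondK
    logCondK_nonneg sum_logDK sum_logQ tpd_le_F F_le K_le sQ_le sLe_le).theorem110_of_localAvg hη hne hcor

/-! ## One dictionary item turned theorem: the canonical local `log(q_v)` and `Σ_{v_ℚ} log(q_{v_ℚ}) = log(q)`

[IUTchIV] Def. 1.9 (ii) (p. 22): `deg_E(𝔞) := deg_F(𝔞_E)/Σ_{v ∈ E} [F_v : ℚ_{v_ℚ}]`; Thm. 1.10 (p. 23):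
`log(q_v) := deg_{𝕍(F)_v}(𝔮)`, `log(q_{v_ℚ}) := deg_{𝕍(F)_{v_ℚ}}(𝔮)`, `log(q) := deg(𝔮)` (normalized degree).
With `𝔮 = Σ_{v ∈ S} ord_v(q_v)[v]` Dupuy–Hilado's `qDivisor` (whose normalised degree `ndeg` they call
[IUTchIV]'s `log(q)`, `PilotDivisors.lean`), the per-place quantity of S3's `DstLocal.logQ` (the one whose
`λ`-weighted AVERAGE is `log(q_{v_ℚ})`) is `log(q_v) = 𝔮(v)·ln|κ(v)|/n_v`; then `Σ_{p ∈ dst} avg_λ log(q_v) =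
ndeg(𝔮)` as soon as `dst` contains the primes under `S`. So the field `sum_logQ` of the local proof data is a
THEOREM for this choice, given the dictionary `X.logq = ndeg(𝔮)`. -/

/-- **The canonical `log(q_v)`** at `v ∣ p` for the pilot data: `𝔮(v)·ln|κ(v)|/[F_v:ℚ_p]`
(`= ord_v(q_v)·log(p)/e_v` at `v ∈ S`, `0` off `S`) — the normalized `{v}`-degree of `𝔮`, Def. 1.9 (ii).
[claim: Mochizuki2012, status: disputed] -/
def logQloc (p : ℕ) (v : placesOver F p) : ℝ :=
  D.X.qDivisor v.1 * logNorm F v.1 / localDegree F v.1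

/-- `log(q_v) ≥ 0`. [claim: Mochizuki2012, status: disputed] -/
theorem logQloc_nonneg (p : ℕ) (v : placesOver F p) : 0 ≤ D.logQloc p v := by
  unfold logQloc
  refine div_nonneg (mul_nonneg ?_ (logNorm_pos F v.1).le) (by positivity)
  -- the coefficient of `𝔮` at `v` is `ord_v(q_v) ≥ 0` on `S` and `0` off `S`
  classical
  show (0 : ℝ) ≤ (∑ w ∈ D.X.S, FinDivisor.of w (D.X.ordq w : ℝ)) v.1
  rw [Finsupp.finsetSum_apply]
  refine Finset.sum_nonneg fun w hw => ?_
  rw [FinDivisor.of, Finsupp.single_apply]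
  split_ifs with h
  · exact_mod_cast (D.X.ordq_pos hw).le
  · exact le_rfl

/-- The coefficient of `𝔮` vanishes off `S`. [cite: DupuyHilado2025, §3.3] -/
theorem qDivisor_apply_eq_zero_of_not_mem {v : HeightOneSpectrum (𝓞 F)} (hv : v ∉ D.X.S) :
    D.X.qDivisor v = 0 := by
  classical
  show (∑ w ∈ D.X.S, FinDivisor.of w (D.X.ordq w : ℝ)) v = 0
  rw [Finsupp.finsetSum_apply]
  exact Finset.sum_eq_zero fun w hw => by
    rw [FinDivisor.of, Finsupp.single_apply, if_neg (show ¬ (w = v) from fun hwv => hv (hwv ▸ hw))]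

/-- The `λ`-weighted average with `λ_v = n_v` is `(Σ_v f_v·n_v)/[F:ℚ]` (`Σ_{v|p} n_v = [F:ℚ]`).
[cite: Mochizuki2012, IUTchIV Rmk 1.7.1 p.17] -/
theorem avg_eq_sum_div {p : ℕ} [Fact p.Prime] (Dl : DstLocal (placesOver F p))
    (hlam : ∀ v, Dl.lam v = localDegree F v.1) (f : placesOver F p → ℝ) :
    Dl.avg f = (∑ v : placesOver F p, f v * localDegree F v.1) / Module.finrank ℚ F := by
  unfold DstLocal.avg Literature.Algebra.PolynomialIdentities.WeightedAverage.betaAvg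
    Literature.Algebra.PolynomialIdentities.WeightedAverage.betaTotal
    Literature.Algebra.PolynomialIdentities.WeightedAverage.lamTotal
  simp_rw [hlam]
  congr 1
  rw [Finset.sum_coe_sort (placesOver F p) (fun v => (localDegree F v : ℝ))]
  exact_mod_cast sum_localDegree F p

/-- **`Σ_{v_ℚ ∈ dst} log(q_{v_ℚ}) = log(q)`** (Def. 1.9 / (D6); the field `sum_logQ` of the local proof data) for
local data whose `log(q_v)` is the canonical one and whose weights are `λ_v = n_v`, whenever `dst` (primes)
contains the primes under `S`: the double sum over `p ∈ dst`, `v ∣ p` regroups to the sum over the support of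
`𝔮`. [claim: Mochizuki2012, status: disputed] -/
theorem sum_avg_logQ_eq_ndeg {dst : Finset ℕ} (hprime : ∀ p ∈ dst, p.Prime)
    (hSdst : ∀ v ∈ D.X.S, residueChar F v ∈ dst)
    (Dloc : (p : ℕ) → DstLocal (placesOver F p))
    (hlam : ∀ p ∈ dst, ∀ v, (Dloc p).lam v = localDegree F v.1)
    (hlogQ : ∀ p ∈ dst, ∀ v, (Dloc p).logQ v = D.logQloc p v) :
    ∑ p ∈ dst, (Dloc p).avg (Dloc p).logQ = FinDivisor.ndeg F D.X.qDivisor := by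
  have hN : (Module.finrank ℚ F : ℝ) ≠ 0 := by exact_mod_cast (Module.finrank_pos).ne'
  -- each average is `(Σ_{v|p} 𝔮(v)·ln|κ(v)|)/[F:ℚ]`
  have step : ∀ p ∈ dst, (Dloc p).avg (Dloc p).logQ =
      (∑ v : placesOver F p, D.X.qDivisor v.1 * logNorm F v.1) / Module.finrank ℚ F := by
    intro p hp
    haveI : Fact p.Prime := ⟨hprime p hp⟩
    rw [avg_eq_sum_div (Dloc p) (hlam p hp)]
    congr 1
    refine Finset.sum_congr rfl fun v _ => ?_
    rw [hlogQ p hp v, logQloc]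
    have hn : (localDegree F v.1 : ℝ) ≠ 0 := by exact_mod_cast (localDegree_pos F v.1).ne'
    field_simp
  rw [Finset.sum_congr rfl step, ← Finset.sum_div, FinDivisor.ndeg_apply]
  congr 1
  -- regroup: `Σ_{p ∈ dst} Σ_{v|p} 𝔮(v)·ln|κ(v)| = deg(𝔮)`
  have hreg := sum_sum_placesOver_of (F := F) D.X.qDivisor dst hprime fun v hv =>
    hSdst v (by by_contra h; exact hv (D.qDivisor_apply_eq_zero_of_not_mem h))
  have := congrArg (FinDivisor.deg F) hreg
  rw [map_sum] at this
  rw [← this]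
  refine Finset.sum_congr rfl fun p _ => ?_
  rw [map_sum]
  exact Finset.sum_congr rfl fun v _ => (FinDivisor.deg_of v.1 _).symm

end DHData

end Summit.ABC.IUTFork

end
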